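import Summits.NavierStokesRegularity.NavierStokesRegularity.Theorems.ScenarioCensusRowF1SharpTop
import Summits.NavierStokesRegularity.NavierStokesRegularity.Theorems.ScenarioCensusRowF1SocketRows
import Literature.Analysis.FluidPDE.LocalHelmholtzSupBound
import HarnessLib

/-!
# LINE 28 «sharp-top» port, part 2/4: §12 THE SHARP TOP — speed-dominated read-outs, `SharpRowOf` / `SharpFloorOf` / `SharpSlackOf`, `readout_nonpos_everywhere_crit`,
# `sharpRowOf_of_kills`, `sharpSlackOf_iff_rowF1`; the two LINE 27 read-outs are speed-dominated

Re-homed for the scenario census (typer seat ns-census-typer-1 g9; the cell F1xf♯ and the floor DSX are MEMBERS OF RECORD «DECIDED IN KERNEL IN FILES» of row F1 since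
census v1.81 (critic idea-crit-3 g8 PASS 04:49Z — no price; ref ns-census-ref g11 PRE-CHECK ✓ §16.4 item 49; lead-presearch label); this port makes them TREE-decided):
VERBATIM PORT of the NEW sections (§8♯, §12, §13) of ns-idea-3 LINE 28 «sharp-top», `pub/ideators/ns-idea-3/lines/sharp-top/line-sharp-top.lean` sha16 3f3b055f6f2a207c
(2536 l., lean check rc 0, 0 sorry; its §1–§5 / §8 / §9–§11 = LINE 27 «liouville-socket» 01bcb6dd501a8321 byte-identical — 106/106 declarations, taken BY NAME from
`ScenarioCensusRowF1Socket*`), split for the 400-line rule into `ScenarioCensusRowF1SharpTop` (§8♯) → `…SharpTopDom` (§12) → `…SharpTopCrit` (§12 end: the critical level as a speed threshold) → `…SharpTopRow` (§13 + census KEYS); each part imports only the parts it uses.  Lean text VERBATIM in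
namespace `…Theorems.ScenarioCensus.SharpTop` (the line's `…Cruxes.ScenarioCensusRowF1.SharpTopLine` re-homed) with `open …ScenarioCensus.LiouvilleSocket`; port edits:
the bracket lines `section IntegralTransferCrit` / `end …` dropped (no `variable`s), `@[conjecture]` on the residual `SharpSlack` (≡ `ScenarioCensus.Row_F1`, OPEN),
one-line docstrings added where missing (gate lint); `norm_cross_le` is the Literature lemma `norm_cross_le_mul_norm` taken BY NAME and the display `rowF1xf_holds'` (a second proof term of LINE 27's row) is not re-declared.  Statements untouched.

No census VALUE is moved here (row F1 stays OPEN-WITH-LINE; the member becomes TREE-decided by name); NS regularity is NOT proved; `Row_F1` is untouched (zero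
movement, `sharpSlack_iff_rowF1`); no summit statement is proved by this file. Lemmas that restate already-landed tree declarations are taken BY NAME (gate lint `dedup.landed`): `fderiv_smul_stPull_apply` = `InviscidTop.fderiv_smul_stPull_apply`, `fderiv_smul_stPull` = `InviscidTop.fderiv_smul_stPull`, `fderiv_fderiv_smul_stPull` = `InviscidTop.fderiv_fderiv_smul_stPull`, `tendsto_clm_of_tendsto_apply` = `InviscidTop.tendsto_clm_of_tendsto_apply`, `tendsto_fderiv_fderiv_apply_of_bound` = `InviscidTop.tendsto_fderiv_fderiv_apply_of_bound`, `tendsto_fderiv_fderiv_of_bound` = `InviscidTop.tendsto_fderiv_fderiv_of_bound`, `tendsto_fderiv_fderiv_of_typeI_seq_Ioo` = `InviscidTop.tendsto_fderiv_fderiv_of_typeI_seq_Ioo`, `fderiv3_smul_stPull` = `FrozenTop.fderiv3_smul_stPull`, `tendsto_fderiv3_of_typeI_seq_Ioo` = `FrozenTop.tendsto_fderiv3_of_typeI_seq_Ioo`, `tendsto_physicalTime` = `ColumnarTop.tendsto_physicalTime`, `eventually_fast` = `ColumnarTop.eventually_fast`, `sqrt_timeLag` = `StretchedTop.sqrt_timeLag`,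 `forall_of_forall_ne_zero` = `StretchedTop.forall_of_forall_ne_zero`, `radius_eq` = `FrozenTop.radius_eq`, `jointCond_everywhere₆` = `FrozenTop.jointCond_everywhere₄`, `continuousOn_quad` = `IntegratedStretch.continuousOn_quad`, `sqrt_nu_timeLag` = `IntegratedStretch.sqrt_nu_timeLag`, `sing_of_not_bounded` = `InviscidTop.sing_of_not_bounded`, `exists_singularZoom_package₃` = `FrozenTop.exists_singularZoom_package₃`, `lapD_eq_zero_of_eq_zero` = `FrozenTop.lapD_eq_zero_of_eq_zero`, `measurableSet_top` = `IntegratedStretch.measurableSet_top`, `norm_cross_le` = `norm_cross_le_mul_norm`.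
-/

-- the summit and its single problem share the name `NavierStokesRegularity` (D-0017 nested layout)
set_option linter.dupNamespace false

noncomputable section

open MeasureTheory Set Function Filter TopologicalSpace Metric
open scoped Topology NNReal ENNReal InnerProductSpace RealInnerProductSpace Laplacian

namespace Summit.NavierStokesRegularity.NavierStokesRegularity.Theorems.ScenarioCensus.SharpTop

open Literature.Analysis Literature.Analysis.FluidPDE
open Summit.NavierStokesRegularity.NavierStokesRegularity.Theorems
open Summit.NavierStokesRegularity.NavierStokesRegularity.Theorems.ScenarioCensus.LiouvilleSocket

/-! ## §12 THE SHARP TOP (NEW in LINE 28): criteria charged ONLY on the CRITICAL fast set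
`{|u|² > κν/(T − t)}` — the super-`√κ`-self-similar-speed set, the SMALLEST set a criterion of this family can live on
(anything slower is invisible in the zoom; by LINE 27's `divergentFastVolume_holds` this set has infinite scale-invariant
volume at every Type-I blow-up, so the sharp criteria are not vacuous).  The sharp socket needs ONE extra property of the
read-out, SPEED DOMINATION (`Rd ≤ 0` at every slow jet), which the cross-flow read-out has (`‖ω × v‖ ≤ |ω| |v|`). -/

/-- **SPEED-DOMINATED read-out at fraction `κ′`**: non-positive at every jet whose velocity is slow, `‖v‖² ≤ κ′ τ⁻¹`. -/
def IsSpeedDominated (κ' : ℝ) (Rd : Readout) : Prop :=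
  ∀ τ : ℝ, 0 < τ → ∀ (v : E3) (L : E3 →L[ℝ] E3) (H : Hess) (K : E3 →L[ℝ] E3),
    ‖v‖ ^ 2 ≤ κ' * τ⁻¹ → Rd τ v L H K ≤ 0

/-- **The SHARP CRITERION ROW of a read-out at fraction `κ′`**: the frame of `Row_F1` plus ONE hypothesis — for some
`t₀ ∈ [0, T)` the normalised one-sided excess of `Rd`, charged ONLY on the critical fast set `{|u| > Λ♯_{κ′}(t)}`, is finite. -/
def SharpRowOf (κ' : ℝ) (Rd : Readout) : Prop :=
  ∀ (ν T : ℝ), 0 < ν → 0 < T → ∀ (u : ℝ → E3 → E3) (p : ℝ → E3 → ℝ),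
    IsClassicalNSSolutionOn (Ico 0 T) ν 0 u p → IsLerayHopfOn T ν 0 (u 0) u →
    HasRapidSpatialDecay (u 0) → IsTypeIBlowup u T →
    (∃ t₀ : ℝ, 0 ≤ t₀ ∧ t₀ < T ∧ ∫⁻ z, topIntegrandτ T ν t₀ (critLevel T ν κ') Rd u z < ⊤) →
    HasSmoothExtensionPast ν 0 u T

/-- **The SHARP FLOOR of a read-out** (maximal frame): infinite sharp excess for every `t₀ ∈ [0, T)`. -/
def SharpFloorOf (κ' : ℝ) (Rd : Readout) : Prop :=
  ∀ (ν T : ℝ), 0 < ν → 0 < T → ∀ (u : ℝ → E3 → E3) (p : ℝ → E3 → ℝ),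
    IsMaximalSmoothSolution ν 0 u p T → IsLerayHopfOn T ν 0 (u 0) u →
    HasRapidSpatialDecay (u 0) → IsTypeIBlowup u T →
    ∀ t₀ : ℝ, 0 ≤ t₀ → t₀ < T → ∫⁻ z, topIntegrandτ T ν t₀ (critLevel T ν κ') Rd u z = ⊤

/-- **The SHARP SLACK of a read-out** (residual, maximal frame). -/
def SharpSlackOf (κ' : ℝ) (Rd : Readout) : Prop :=
  ∀ (ν T : ℝ), 0 < ν → 0 < T → ∀ (u : ℝ → E3 → E3) (p : ℝ → E3 → ℝ),
    IsMaximalSmoothSolution ν 0 u p T → IsLerayHopfOn T ν 0 (u 0) u →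
    HasRapidSpatialDecay (u 0) → IsTypeIBlowup u T →
    ∃ t₀ : ℝ, 0 ≤ t₀ ∧ t₀ < T ∧ ∫⁻ z, topIntegrandτ T ν t₀ (critLevel T ν κ') Rd u z < ⊤

/-- **Sharp globalisation** (no analyticity needed): `Rd ≤ 0` on the limit fast set by transfer and on the slow set by
speed domination. -/
theorem readout_nonpos_everywhere_crit {Rd : Readout} {κ' : ℝ} (hdom : IsSpeedDominated κ' Rd) {W : ℝ → E3 → E3}
    (h : ∀ s < (0 : ℝ), ∀ y, κ' < -s * ‖W s y‖ ^ 2 →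
      Rd (-s) (W s y) (fderiv ℝ (W s) y) (fderiv ℝ (fderiv ℝ (W s)) y) (lapD (W s) y) ≤ 0) :
    ∀ s < (0 : ℝ), ∀ y,
      Rd (-s) (W s y) (fderiv ℝ (W s) y) (fderiv ℝ (fderiv ℝ (W s)) y) (lapD (W s) y) ≤ 0 := by
  intro s hs y
  by_cases hf : κ' < -s * ‖W s y‖ ^ 2
  · exact h s hs y hf
  · refine hdom (-s) (neg_pos.2 hs) _ _ _ _ ?_
    rw [not_lt] at hf
    rw [← div_eq_mul_inv, le_div_iff₀ (neg_pos.2 hs)]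
    linarith [mul_comm (-s) (‖W s y‖ ^ 2)]

/-- **THE SHARP SOCKET (criterion side)**: an admissible, speed-dominated read-out that kills `𝒦` yields a PROVED SHARP
criterion row (`0 ≤ κ′`).  Engine: singular zoom → CRITICAL-LEVEL transfer `integral_transfer₆τ_crit` (`Rd ≤ 0` on the
open limit fast set) → speed domination on the slow set → the kill. -/
theorem sharpRowOf_of_kills {Rd : Readout} {κ' : ℝ} (hκ' : 0 ≤ κ') (hRd : IsAdmissible Rd)
    (hdom : IsSpeedDominated κ' Rd) (hK : Kills Rd) : SharpRowOf κ' Rd := by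
  intro ν T hν hT u p hsol hLH hdec hTI htop
  obtain ⟨t₀, ht₀, ht₀T, hfin⟩ := htop
  obtain ⟨M, hM⟩ := exists_isTypeIBlowupWith hν hTI
  apply hasSmoothExtensionPast_of_forall_exists_parabolicCylinder hν hT hsol hLH hdec
  intro x₀
  by_contra hno
  obtain ⟨α, β, R, c, W, hα, hβ, hR, hαR, hαν, hcpos, hclim, hW, hpt, hgrad, hhess, hlap, t, ht, y, hne⟩ :=
    FrozenTop.exists_singularZoom_package₃ hν hT hsol hLH hdec hM x₀ (InviscidTop.sing_of_not_bounded hno)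
  have htr := integral_transfer₆τ_crit hν hsol hW ht₀ ht₀T hα hβ hαR hαν hcpos hclim hpt hgrad hhess hlap
    (Rd := Rd) hRd.cont hRd.smul hκ' hfin
  exact hne (hK M W hW (readout_nonpos_everywhere_crit hdom htr) t ht y)

/-- **THE SHARP SOCKET (floor side).** -/
theorem sharpFloorOf_of_kills {Rd : Readout} {κ' : ℝ} (hκ' : 0 ≤ κ') (hRd : IsAdmissible Rd)
    (hdom : IsSpeedDominated κ' Rd) (hK : Kills Rd) : SharpFloorOf κ' Rd := by
  intro ν T hν hT u p hmax hLH hdec hTI t₀ ht₀ ht₀T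
  by_contra hne
  exact hmax.2 (sharpRowOf_of_kills hκ' hRd hdom hK ν T hν hT u p hmax.1 hLH hdec hTI
    ⟨t₀, ht₀, ht₀T, lt_top_iff_ne_top.2 hne⟩)

/-- **THE SHARP SOCKET (split)**: a sharp row and its sharp slack give `Row_F1`. -/
theorem rowF1_of_sharpRowOf_of_sharpSlackOf {Rd : Readout} {κ' : ℝ} (hR : SharpRowOf κ' Rd)
    (hS : SharpSlackOf κ' Rd) : ScenarioCensus.Row_F1 := by
  unfold ScenarioCensus.Row_F1
  intro ν T hν hT u p hsol hLH hdec hTI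
  by_contra hext
  obtain ⟨t₀, ht₀, ht₀T, hfin⟩ := hS ν T hν hT u p ⟨hsol, hext⟩ hLH hdec hTI
  exact hext (hR ν T hν hT u p hsol hLH hdec hTI ⟨t₀, ht₀, ht₀T, hfin⟩)

/-- `Row_F1` ⇒ every sharp slack (vacuously). -/
theorem sharpSlackOf_of_rowF1 (κ' : ℝ) (Rd : Readout) (h : ScenarioCensus.Row_F1) : SharpSlackOf κ' Rd :=
  fun ν T hν hT u p hmax hLH hdec hTI => (hmax.2 (h ν T hν hT u p hmax.1 hLH hdec hTI)).elim

/-- **The sharp slack of an admissible, speed-dominated, killing read-out is EXACTLY `Row_F1`** (declared). -/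
theorem sharpSlackOf_iff_rowF1 {Rd : Readout} {κ' : ℝ} (hκ' : 0 ≤ κ') (hRd : IsAdmissible Rd)
    (hdom : IsSpeedDominated κ' Rd) (hK : Kills Rd) : SharpSlackOf κ' Rd ↔ ScenarioCensus.Row_F1 :=
  ⟨rowF1_of_sharpRowOf_of_sharpSlackOf (sharpRowOf_of_kills hκ' hRd hdom hK), sharpSlackOf_of_rowF1 κ' Rd⟩

/-! ### The two read-outs of LINE 27 are speed-dominated -/

-- `norm_cross_le`: the line restates the tree's `norm_cross_le_mul_norm`; taken BY NAME (gate lint dedup.landed).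

/-- The cross-flow read-out `xflOf κ` is speed-dominated at every fraction `κ′ ≤ κ`
(`‖ω × v‖² − κ τ⁻¹|ω|² ≤ |ω|²(‖v‖² − κ τ⁻¹) ≤ 0` at a slow jet). -/
theorem isSpeedDominated_xflOf {κ κ' : ℝ} (h : κ' ≤ κ) : IsSpeedDominated κ' (xflOf κ) := by
  intro τ hτ v L H K hv
  unfold xflOf
  have h1 : ‖cross (curlCLM L) v‖ ^ 2 ≤ (‖curlCLM L‖ * ‖v‖) ^ 2 :=
    pow_le_pow_left₀ (norm_nonneg _) (norm_cross_le_mul_norm _ _) 2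
  have h2 : ‖curlCLM L‖ ^ 2 * ‖v‖ ^ 2 ≤ ‖curlCLM L‖ ^ 2 * (κ' * τ⁻¹) :=
    mul_le_mul_of_nonneg_left hv (sq_nonneg _)
  have h3 : ‖curlCLM L‖ ^ 2 * (κ' * τ⁻¹) ≤ κ * (τ⁻¹ * ‖curlCLM L‖ ^ 2) := by
    have h0 : 0 ≤ τ⁻¹ * ‖curlCLM L‖ ^ 2 := mul_nonneg (inv_nonneg.2 hτ.le) (sq_nonneg _)
    nlinarith
  rw [mul_pow] at h1
  linarith

/-- The speed read-out `spdOf κ` is speed-dominated at every fraction `κ′ ≤ κ`. -/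
theorem isSpeedDominated_spdOf {κ κ' : ℝ} (h : κ' ≤ κ) : IsSpeedDominated κ' (spdOf κ) := by
  intro τ hτ v L H K hv
  unfold spdOf
  refine mul_nonpos_iff.2 (Or.inl ⟨inv_nonneg.2 (sq_nonneg τ), sub_nonpos.2 ?_⟩)
  exact hv.trans (mul_le_mul_of_nonneg_right h (inv_nonneg.2 hτ.le))

end Summit.NavierStokesRegularity.NavierStokesRegularity.Theorems.ScenarioCensus.SharpTop

end
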